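import Summits.AtomisticToContinuum.BoseEinsteinCondensation.Theorems.BECGroundStateSOSPeriodicIRBoundDefs
import Summits.AtomisticToContinuum.BoseEinsteinCondensation.Theorems.BECGroundStateSOSPeriodicIRBoundWFDefs
import Summits.AtomisticToContinuum.BoseEinsteinCondensation.Theorems.BECGroundStateSOSPeriodicIRBoundWFHeartKin2
import Summits.AtomisticToContinuum.BoseEinsteinCondensation.Theorems.BECGroundStateSOSPeriodicIRBoundWFPotCreate3
import Summits.AtomisticToContinuum.BoseEinsteinCondensation.Theorems.BECGroundStateSOSPeriodicIRBoundWFPolar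
import Summits.AtomisticToContinuum.BoseEinsteinCondensation.Theorems.BECGroundStateSOSPeriodicIRBoundWFFormBounds
import Literature.MathematicalPhysics.QuantumManyBody.PeriodicBoseGasMomentumSector
import Literature.MathematicalPhysics.QuantumManyBody.TorusFockLayer
import Literature.MathematicalPhysics.QuantumManyBody.TorusFockSectorInteraction
import Literature.MathematicalPhysics.QuantumManyBody.PeriodicFormDomain
import Literature.MathematicalPhysics.QuantumManyBody.OneBodyCurrentGain
import HarnessLib

/-! # Crux `PeriodicIRBound` (stmt-AtomisticToContinuum-3972), line `linear-ph-floor-wagner`, stub 5b `stub_wagnerFeynman` — HeartGlue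
D1, the Wagner–Feynman form inequality `𝓔[a_kΦ] + 𝓔[a_k†Φ] ≤ (|2πk/L|² + 2(n+2)‖w‖₁/L³)‖Φ‖² + 𝓔[Φ] + 2 Re B_w(Φ, n̂_kΦ)` for core `(n+2)`-body `Φ`. -/

/-!
# Stub 5b (`stub_wagnerFeynman`), §D1: the Wagner–Feynman form inequality (glue of the kinetic identity
and the potential inequality)

`𝓔_w[a_kΦ] + 𝓔_w[a_k†Φ] ≤ (|2πk/L|² + 2(n+2)‖w‖₁/L³)‖Φ‖² + 𝓔_w[Φ] + 2 Re B_w(Φ, n̂_kΦ)` (reals).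
Inputs (exact statements; proved in `WFHeartKin.lean` (kinetic identity `kinetic_wagnerFeynman`, `formRe_zero_numOp`,
-/

noncomputable section

open scoped BigOperators ENNReal ComplexConjugate Topology
open Filter MeasureTheory

namespace Summit.AtomisticToContinuum.BoseEinsteinCondensation.Cruxes.PeriodicIRBound.LinearPhFloorWagner.WF

open Literature.MathematicalPhysics.QuantumManyBody.BoseGas

variable {M m n : ℕ} {L : ℝ}

/-! ### Bookkeeping -/

/-- `P_0 = 0`. -/
theorem potForm_zero (L : ℝ) (f : Config M → ℂ) : potForm 0 L f = 0 := by
  unfold potForm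
  simp only [periodicInteraction_zero, zero_mul, lintegral_zero]

/-- `potRe_0 = 0`. -/
theorem potRe_zero (L : ℝ) (f g : Config M → ℂ) : potRe 0 L f g = 0 := by
  unfold potRe
  simp only [periodicInteraction_zero, ENNReal.toReal_zero, zero_mul, integral_zero]

/-- The kinetic energy of a `C¹` function on the cell is finite. -/
private theorem lintegral_kineticDensity_ne_top (L : ℝ) {f : Config M → ℂ} (hf : ContDiff ℝ 1 f) :
    (∫⁻ X in cellN M L, kineticDensity f X) ≠ ⊤ := by
  rw [lintegral_kineticDensity_eq hf L]; exact ENNReal.ofReal_ne_top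

/-- `Re B_w(f,g) = Re B_0(f,g) + potRe_w(f,g)` for `C¹ f, g` with finite potential parts. -/
theorem formRe_eq_formRe_zero_add_potRe {w : ℝ → ℝ≥0∞} (hw : Measurable w) {f g : Config M → ℂ}
    (hf : ContDiff ℝ 1 f) (hg : ContDiff ℝ 1 g) (hPf : potForm w L f ≠ ⊤) (hPg : potForm w L g ≠ ⊤) :
    formRe w L f g = formRe 0 L f g + potRe w L f g := by
  rw [formRe_eq_integral_add hw hf hg hPf hPg,
    formRe_eq_integral_add (w := 0) measurable_const hf hg (by rw [potForm_zero]; exact ENNReal.zero_ne_top)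
      (by rw [potForm_zero]; exact ENNReal.zero_ne_top)]
  have h0 : (∫ X in cellN M L, (periodicInteraction 0 L X).toReal * (conj (f X) * g X).re) = 0 := by
    simp only [periodicInteraction_zero, ENNReal.toReal_zero, zero_mul, integral_zero]
  rw [h0, add_zero]
  rfl

/-- `ε_p = |2πp/L|²` as a real number. -/
theorem toReal_eps (L : ℝ) (p : Fin 3 → ℤ) : (eps L p).toReal = ‖latticeVec (2 * Real.pi / L) p‖ ^ 2 := by
  rw [eps, ENNReal.toReal_ofReal (sq_nonneg _), waveVector_eq_latticeVec]

/-! ### D1 -/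

/-- **D1 (the Wagner–Feynman form inequality)** at particle number `n + 2`. -/
theorem wagnerFeynman_form_le (hL : 0 < L) {w : ℝ → ℝ≥0∞} (hw : Measurable w) (hint : (∫⁻ x : Space, w ‖x‖) ≠ ⊤)
    {k : Fin 3 → ℤ} (hk : k ≠ 0) {Φ : Config (n + 2) → ℂ} (hΦ : IsCore L Φ) (hΦE : qform w L Φ ≠ ⊤) :
    (qform w L (modeAn L (planeWaveMode L k) Φ)).toReal + (qform w L (modeCr (planeWaveMode L k) Φ)).toReal ≤
      (‖latticeVec (2 * Real.pi / L) k‖ ^ 2 + 2 * (n + 2) * (∫⁻ x : Space, w ‖x‖).toReal / L ^ 3) *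
          (normSq L Φ).toReal +
        (qform w L Φ).toReal +
        2 * formRe w L Φ (modeCr (planeWaveMode L k) (modeAn L (planeWaveMode L k) Φ)) := by
  have _hk := hk
  -- the functions
  set aΦ := modeAn L (planeWaveMode L k) Φ with haΦ
  set cΦ := modeCr (planeWaveMode L k) Φ with hcΦ
  set NΦ := modeCr (planeWaveMode L k) aΦ with hNΦ
  have haΦc : IsCore L aΦ := isCore_modeAn hL k hΦ
  have hcΦc : IsCore L cΦ := isCore_modeCr hL k hΦ
  have hNΦc : IsCore L NΦ := isCore_modeCr hL k haΦc
  -- finiteness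
  have hPΦ : potForm w L Φ ≠ ⊤ := ne_top_of_le_ne_top hΦE (potForm_le_qform' w L Φ)
  obtain ⟨hPa, hPc⟩ := potForm_modeAn_ne_top_and hL hw hint k hΦ hPΦ
  obtain ⟨_, hPN⟩ := potForm_modeAn_ne_top_and hL hw hint k haΦc hPa
  have hTa := lintegral_kineticDensity_ne_top L haΦc.contDiff
  have hTc := lintegral_kineticDensity_ne_top L hcΦc.contDiff
  have hTΦ := lintegral_kineticDensity_ne_top L hΦ.contDiff
  have hK := kinCrossENN_ne_top hL k hΦ
  have hnΦ : normSq L Φ ≠ ⊤ := (lintegral_cellN_sq_lt_top L hΦ.contDiff.continuous).ne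
  have hεn : eps L k * normSq L Φ ≠ ⊤ := ENNReal.mul_ne_top ENNReal.ofReal_ne_top hnΦ
  -- kinetic identity in reals
  have hkin := kinetic_wagnerFeynman hL k hΦ
  have hkinR : (∫⁻ Y in cellN (n + 1) L, kineticDensity aΦ Y).toReal + (∫⁻ Z in cellN (n + 3) L, kineticDensity cΦ Z).toReal =
      ‖latticeVec (2 * Real.pi / L) k‖ ^ 2 * (normSq L Φ).toReal + (∫⁻ X in cellN (n + 2) L, kineticDensity Φ X).toReal +
        2 * formRe 0 L Φ NΦ := by
    have h := congrArg ENNReal.toReal hkin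
    rw [ENNReal.toReal_add hTa hTc, ENNReal.toReal_add (ENNReal.add_ne_top.2 ⟨hεn, hTΦ⟩)
      (ENNReal.mul_ne_top ENNReal.ofNat_ne_top hK), ENNReal.toReal_add hεn hTΦ, ENNReal.toReal_mul,
      ENNReal.toReal_mul, toReal_eps, ENNReal.toReal_ofNat] at h
    rw [h, formRe_zero_numOp hL k hΦ]
  -- potential inequality in reals
  have hpot := pot_wagnerFeynman hL hw hint k hΦ hPΦ
  -- the polarised form splits
  have hform : formRe w L Φ NΦ = formRe 0 L Φ NΦ + potRe w L Φ NΦ :=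
    formRe_eq_formRe_zero_add_potRe hw hΦ.contDiff hNΦc.contDiff hPΦ hPN
  -- the three energies split
  have hqa : (qform w L aΦ).toReal = (∫⁻ Y in cellN (n + 1) L, kineticDensity aΦ Y).toReal + (potForm w L aΦ).toReal := by
    rw [qform_eq_lintegral_kineticDensity_add_potForm, ENNReal.toReal_add hTa hPa]
  have hqc : (qform w L cΦ).toReal = (∫⁻ Z in cellN (n + 3) L, kineticDensity cΦ Z).toReal + (potForm w L cΦ).toReal := by
    rw [qform_eq_lintegral_kineticDensity_add_potForm, ENNReal.toReal_add hTc hPc]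
  have hqΦ : (qform w L Φ).toReal = (∫⁻ X in cellN (n + 2) L, kineticDensity Φ X).toReal + (potForm w L Φ).toReal := by
    rw [qform_eq_lintegral_kineticDensity_add_potForm, ENNReal.toReal_add hTΦ hPΦ]
  -- assemble
  have hcoef : 2 * ((↑(n + 1) + 1 : ℝ) * wL1 w / L ^ 3) * (normSq L Φ).toReal =
      (2 * (n + 2) * (∫⁻ x : Space, w ‖x‖).toReal / L ^ 3) * (normSq L Φ).toReal := by
    rw [wL1]; push_cast; ring
  rw [hqa, hqc, hqΦ, hform]
  rw [hcoef] at hpot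
  nlinarith [hkinR, hpot]

end Summit.AtomisticToContinuum.BoseEinsteinCondensation.Cruxes.PeriodicIRBound.LinearPhFloorWagner.WF

end

namespace Summit.AtomisticToContinuum.BoseEinsteinCondensation.Cruxes.PeriodicIRBound.LinearPhFloorWagner

/-- The registered sub-goal `stub_wfHeartGlue` of the crux ledger: this file's headline lemma `WF.wagnerFeynman_form_le`. -/
theorem stub_wfHeartGlue : WF.Pkg.HeartGlue :=
  @WF.wagnerFeynman_form_le

end Summit.AtomisticToContinuum.BoseEinsteinCondensation.Cruxes.PeriodicIRBound.LinearPhFloorWagner
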